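import Summits.HodgeConjecture.HodgeConjecture.Theorems.SignSymmetricPowersLinkConfluenceN
import Literature.AlgebraicGeometry.HodgeTheory.PicardLefschetzSymmetricA3Solo
import Summits.HodgeConjecture.HodgeConjecture.Theorems.SignSymmetricPowersLinkConfluenceNKeyed
import HarnessLib

/-!
# The symmetric `A₃` confluence read at a base point — from hN ONLY (both Picard–Lefschetz inputs DISCHARGED: prover-Bx p680592, 20241-p1 p684662)

Prover seat `hodge-nonav-19716-p2` (g10), cell `hodge-nonav`; helper file `--supports stmt-HodgeConjecture-19716`; sorry-free, no
definition, no new named fact.  P3 g34 DECISION (2) 2026-08-29T00:07:12Z.  Twin of `SignSymmetricPowersLinkConfluenceNKeyed` in which the one-node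
binder hPL₁ is REPLACED BY THE THEOREM `NodalPencil.picardLefschetz_oneNode_monomial` (prover-Bx, p680592) through
`symmetricA3PicardLefschetzPair₂_of_exchangedPair`, at the price of the hypothesis `g₀ = a·xᵢ^d` (true at the consumption site, where `g₀ := x_j^d`);
`trans_comm_of_orthogonal₂` reused.

* `exists_confluence_at_of_nonComm_solo` — the confluence read at `t`, from hN alone (via `symmetricA3PicardLefschetzPair₂_solo`).

CONDITIONAL on {hN}; nothing here proves HC; rung F-H1 not moved.
-/

noncomputable section

set_option linter.dupNamespace false

open CategoryTheory AlgebraicGeometry MvPolynomial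
open scoped unitInterval
open Literature.AlgebraicTopology.SingularHomology
open Literature.AlgebraicGeometry.Motives Literature.AlgebraicGeometry.Motives.UniversalHypersurface
open Literature.AlgebraicGeometry.HodgeTheory Literature.AlgebraicGeometry.HodgeTheory.UniversalHypersurface
open Literature.AlgebraicGeometry.HodgeTheory.BettiUniverse
open Summit.HodgeConjecture.HodgeConjecture.Theorems.SignSymmetricPowersLinkTransport
open Summit.HodgeConjecture.HodgeConjecture.Theorems.SignSymmetricPowersLinkConfluence

namespace Summit.HodgeConjecture.HodgeConjecture.Theorems.SignSymmetricPowersLinkConfluenceNSolo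

open Summit.HodgeConjecture.HodgeConjecture.Theorems.SignSymmetricPowersLinkConfluenceNKeyed (trans_comm_of_orthogonal₂)

/-! ### §1 The confluence read at a base point, from hPL₂exch ∧ hN (one-node input = theorem) -/

section Main

variable (n d : ℕ) (M : Set (DegIndex n d)) (γ : Fin (n + 2) → ℂˣ)

/-- **The symmetric `A₃` confluence read at a base point — from hN alone** (odd fibre dimension; two coefficients; `g₀` a monomial;
the one-node circle served by prover-Bx's theorem): verbatim `SignSymmetricPowersLinkConfluenceNKeyed.exists_confluence_at_of_nonComm_keyed` with the
pair data supplied by `symmetricA3PicardLefschetzPair₂_of_exchangedPair` (coefficient `c₁` on the one-node circle, `c₂` on the exchanged-pair circle), the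
NON-ORTHOGONALITY clause `c₁B_t(e₂, c₂B_t(e₂,e₃)e₃ + c₂B_t(e₂,e₁)e₁) ≠ 0` (from hN via `trans_comm_of_orthogonal₂`: it equals
`c₁c₂(B(e₂,e₁)² + B(e₂,e₃)²)` up to the transport similitude), and the Picard–Lefschetz formulas of `T₁` (coefficient `c₁`) and `T₂` (`c₂`).
[cite: ArnoldGuseinzadeVarchenko2012, Part I §5.2] [cite: VoisinHodgeII2003, §3.2.1 Thm. 3.16 and §3.2.2] -/
theorem exists_confluence_at_of_nonComm_solo
    (hNC : ∀ (n d : ℕ) (f₁ g₀ g₂ : MvPolynomial (Fin (n + 2)) ℂ) (j k : Fin (n + 2)) (a : Fin (n + 2) → ℂˣ),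
      1 ≤ n → 1 ≤ d → f₁.IsHomogeneous d → g₀.IsHomogeneous d → g₂.IsHomogeneous d → IsSymmetricA3Datum f₁ g₀ g₂ j k a →
      ∀ (εa εb : ℝ) (ψ : ℂ → ℂ), IsSymmetricA3Bifurcation f₁ g₀ g₂ j a εa εb ψ →
        ∃ εa' : ℝ, 0 < εa' ∧ εa' ≤ εa ∧ SymmetricA3NonCommutation n d f₁ g₀ g₂ ψ εa')
    (hn : 1 ≤ n) (hd : 1 ≤ d) (hodd : Odd n)
    (hγ : FixesMonomials ℂ n d M γ) (hU : IsCohomologicallyLocallyTrivialOn (familyM ℂ n d M) Set.univ)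
    {f₁ g₀ g₂ : MvPolynomial (Fin (n + 2)) ℂ} (hf₁ : f₁.IsHomogeneous d) (hg₀ : g₀.IsHomogeneous d)
    (hg₂ : g₂.IsHomogeneous d) (hg₀mono : ∃ (i : Fin (n + 2)) (a : ℂ), g₀ = a • MvPolynomial.X i ^ d)
    (hM₁ : IsSupportedOn n d M f₁) (hM₀ : IsSupportedOn n d M g₀)
    (hM₂ : IsSupportedOn n d M g₂) {j k : Fin (n + 2)} (hD : IsSymmetricA3Datum f₁ g₀ g₂ j k γ)
    (hg₀X : ∀ q : Fin (n + 2) → ℂ, MvPolynomial.eval q g₀ = 0 → ∀ i, MvPolynomial.eval q (pderiv i g₀) = 0)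
    (t : ComplexPoints (baseM ℂ n d M)) :
    ∃ (F₁ F₂ G₁ G₂ : MvPolynomial (Fin (n + 2)) ℂ) (q : Fin (n + 2) → ℂ) (ε : ℝ)
      (s : ComplexPoints (baseM ℂ n d M)) (κ : Path t s) (ω₁ ω₂ : Path s s)
      (T₁ T₂ : bettiCohomology (fiberOver (familyM ℂ n d M) t) n ≃ₗ[ℚ] bettiCohomology (fiberOver (familyM ℂ n d M) t) n)
      (e₁ e₂ e₃ : bettiCohomology (fiberOver (familyM ℂ n d M) t) n) (c₁ c₂ : ℚ),
      F₁.IsHomogeneous d ∧ F₂.IsHomogeneous d ∧ G₁.IsHomogeneous d ∧ G₂.IsHomogeneous d ∧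
      IsSupportedOn n d M F₁ ∧ IsSupportedOn n d M F₂ ∧ IsSupportedOn n d M G₁ ∧ IsSupportedOn n d M G₂ ∧
      IsNodalFormWithNodes F₁ ![Pi.single j (1 : ℂ)] ∧ MvPolynomial.eval (Pi.single j (1 : ℂ)) G₁ ≠ 0 ∧
      IsNodalFormWithNodes F₂ ![q, fun i => (γ i : ℂ) * q i] ∧
      (∀ i : Fin 2, MvPolynomial.eval ((![q, fun i => (γ i : ℂ) * q i] : Fin 2 → Fin (n + 2) → ℂ) i) G₂ ≠ 0) ∧
      0 < ε ∧
      (∀ c : ℂ, c ≠ 0 → ‖c‖ ≤ ε → SmoothHypersurface.IsNonsingularForm ℂ (F₁ + c • G₁)) ∧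
      (∀ c : ℂ, c ≠ 0 → ‖c‖ ≤ ε → SmoothHypersurface.IsNonsingularForm ℂ (F₂ + c • G₂)) ∧
      pointFormM ℂ n d M s = F₁ + ((ε : ℝ) : ℂ) • G₁ ∧ pointFormM ℂ n d M s = F₂ + ((ε : ℝ) : ℂ) • G₂ ∧
      IsPencilCircle n d F₁ G₁ ε (ω₁.map (AlgPoints.mapContinuous (toBase ℂ n d M)).continuous) ∧
      IsPencilCircle n d F₂ G₂ ε (ω₂.map (AlgPoints.mapContinuous (toBase ℂ n d M)).continuous) ∧
      IsRatTransport (familyM ℂ n d M) n hU ⟦((κ.trans ω₁).trans κ.symm).map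
        (⟨fun s => ⟨s, Set.mem_univ s⟩, continuous_id.subtype_mk _⟩ :
          C(ComplexPoints (baseM ℂ n d M), (Set.univ : Set (ComplexPoints (baseM ℂ n d M))))).continuous⟧ T₁ ∧
      IsRatTransport (familyM ℂ n d M) n hU ⟦((κ.trans ω₂).trans κ.symm).map
        (⟨fun s => ⟨s, Set.mem_univ s⟩, continuous_id.subtype_mk _⟩ :
          C(ComplexPoints (baseM ℂ n d M), (Set.univ : Set (ComplexPoints (baseM ℂ n d M))))).continuous⟧ T₂ ∧
      tr (isSmoothProjective_fiberOver_familyM ℂ n d M hn hd t) (n + n)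
        (cup (fiberOver (familyM ℂ n d M) t) n n e₁ e₃) = 0 ∧
      c₁ * tr (isSmoothProjective_fiberOver_familyM ℂ n d M hn hd t) (n + n)
        (cup (fiberOver (familyM ℂ n d M) t) n n e₂
          ((c₂ * tr (isSmoothProjective_fiberOver_familyM ℂ n d M hn hd t) (n + n)
              (cup (fiberOver (familyM ℂ n d M) t) n n e₂ e₃)) • e₃ +
            (c₂ * tr (isSmoothProjective_fiberOver_familyM ℂ n d M hn hd t) (n + n)
              (cup (fiberOver (familyM ℂ n d M) t) n n e₂ e₁)) • e₁)) ≠ 0 ∧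
      (∀ x, T₁ x = x + (c₁ * tr (isSmoothProjective_fiberOver_familyM ℂ n d M hn hd t) (n + n)
        (cup (fiberOver (familyM ℂ n d M) t) n n x e₂)) • e₂) ∧
      (∀ x, T₂ x = x + (c₂ * tr (isSmoothProjective_fiberOver_familyM ℂ n d M hn hd t) (n + n)
        (cup (fiberOver (familyM ℂ n d M) t) n n x e₁)) • e₁ +
        (c₂ * tr (isSmoothProjective_fiberOver_familyM ℂ n d M hn hd t) (n + n)
          (cup (fiberOver (familyM ℂ n d M) t) n n x e₃)) • e₃) := by
  have hUU := UniversalHypersurface.isCohomologicallyLocallyTrivialOn_family n d hd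
  -- bifurcation data (programme B2-BIF), pair data (keyed binders, two coefficients), non-commutation (hN): shrink to a common radius
  obtain ⟨εa, εb, ψ, hBif0⟩ := hD.exists_isSymmetricA3Bifurcation hf₁ hg₀ hg₂
  obtain ⟨ε₁, h₁, h₁le, hP₁⟩ := symmetricA3PicardLefschetzPair₂_solo hodd hg₀mono hf₁ hg₀ hg₂ hD hBif0
  obtain ⟨ε₂, h₂, h₂le, hN₂⟩ := hNC n d f₁ g₀ g₂ j k γ hn hd hf₁ hg₀ hg₂ hD εa εb ψ hBif0
  have hBif := hBif0.mono (lt_min h₁ h₂) ((min_le_left _ _).trans h₁le)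
  -- the loops of the confluence in `S_M(ℂ)`
  obtain ⟨a', F₁, F₂, G₁, G₂, q, ε, s, ω₁, ω₂, ha, ha0, hs, hω₁f, hω₂f, hF₁h, hF₂h, hG₁h, hG₂h, hF₁M, hF₂M, hG₁M,
    hG₂M, hnod₁, hG₁e, hnod₂, hG₂q, hε, hns₁, hns₂, hsF₁, hsF₂, hpc₁, hpc₂⟩ :=
    exists_confluenceLoops n d M γ hd hf₁ hg₀ hg₂ hM₁ hM₀ hM₂ hD hg₀X hBif
  -- pair data at the image loops, and THE transports
  obtain ⟨c₁, c₂, e₁, e₂, e₃, hPL₁, hPL₂⟩ := hP₁ hn hd hUU a' (lt_of_lt_of_le ha (min_le_left ε₁ ε₂)) ha0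
    (AlgPoints.map (toBase ℂ n d M) s) hs
    (ω₁.map (AlgPoints.mapContinuous (toBase ℂ n d M)).continuous)
    (ω₂.map (AlgPoints.mapContinuous (toBase ℂ n d M)).continuous) hω₁f hω₂f
  obtain ⟨T₁', hT₁', hT₁x'⟩ := hPL₁.2.2.1
  obtain ⟨T₂', hT₂', hT₂x'⟩ := hPL₂.2.2.1
  have hNC' := (hN₂.mono (min_le_right ε₁ ε₂)) hUU a' ha ha0 (AlgPoints.map (toBase ℂ n d M) s) hs
    (ω₁.map (AlgPoints.mapContinuous (toBase ℂ n d M)).continuous)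
    (ω₂.map (AlgPoints.mapContinuous (toBase ℂ n d M)).continuous) hω₁f hω₂f T₁' T₂' hT₁' hT₂'
  -- non-commutation ⟹ `S = B(e₂,e₁)² + B(e₂,e₃)² ≠ 0`
  have hI : (tr ((isSmoothProjectiveFamily_family ℂ hn hd).isSmoothProjective _) (n + n)
      (cup (fiberOver (family ℂ n d) (AlgPoints.map (toBase ℂ n d M) s)) n n e₂ e₁)) ^ 2 +
      (tr ((isSmoothProjectiveFamily_family ℂ hn hd).isSmoothProjective _) (n + n)
      (cup (fiberOver (family ℂ n d) (AlgPoints.map (toBase ℂ n d M) s)) n n e₂ e₃)) ^ 2 ≠ 0 := by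
    intro hI0
    obtain ⟨h1, h3⟩ := (add_eq_zero_iff_of_nonneg (sq_nonneg _) (sq_nonneg _)).1 hI0
    have h21 := (pow_eq_zero_iff two_ne_zero).1 h1
    have h23 := (pow_eq_zero_iff two_ne_zero).1 h3
    exact hNC' (trans_comm_of_orthogonal₂ hn hd hPL₁ hPL₂ hT₁' hT₂' h21 h23)
  -- a path from `t` to `s`, and the transport datum along it
  haveI := pathConnectedSpace_complexPoints_baseM n d M t
  let κ : Path t s := (PathConnectedSpace.joined t s).somePath
  obtain ⟨Φ, ρ, ν, hρ, hν, hρν, hsim, -, htrans⟩ := exists_transportDatum n d M γ hn hd hγ hUU hU κ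
  obtain ⟨T₁, hT₁, hT₁x⟩ := htrans 1 ω₁ ![e₂] c₁ hPL₁
  obtain ⟨T₂, hT₂, hT₂x⟩ := htrans 2 ω₂ ![e₁, e₃] c₂ hPL₂
  refine ⟨F₁, F₂, G₁, G₂, q, ε, s, κ, ω₁, ω₂, T₁, T₂, Φ e₁, Φ e₂, Φ e₃, c₁ * ρ, c₂ * ρ, hF₁h, hF₂h, hG₁h, hG₂h, hF₁M, hF₂M,
    hG₁M, hG₂M, hnod₁, hG₁e, hnod₂, hG₂q, hε, hns₁, hns₂, hsF₁, hsF₂, hpc₁, hpc₂, hT₁, hT₂, ?_, ?_,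
    fun x => ?_, fun x => ?_⟩
  · have h13 := hPL₂.orthogonal (show (0 : Fin 2) ≠ 1 by decide)
    simp only [Matrix.cons_val_zero, Matrix.cons_val_one] at h13
    rw [hsim, h13, mul_zero]
  · -- the non-orthogonality clause is transport-invariant: it equals `c₁c₂·S ≠ 0`
    set X21 := tr ((isSmoothProjectiveFamily_family ℂ hn hd).isSmoothProjective _) (n + n)
      (cup (fiberOver (family ℂ n d) (AlgPoints.map (toBase ℂ n d M) s)) n n e₂ e₁) with hX21
    set X23 := tr ((isSmoothProjectiveFamily_family ℂ hn hd).isSmoothProjective _) (n + n)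
      (cup (fiberOver (family ℂ n d) (AlgPoints.map (toBase ℂ n d M) s)) n n e₂ e₃) with hX23
    simp only [map_add, map_smul, smul_eq_mul, hsim]
    intro h0
    apply mul_ne_zero (mul_ne_zero hPL₁.c_ne_zero hPL₂.c_ne_zero) hI
    linear_combination h0 - c₁ * c₂ * (X21 ^ 2 + X23 ^ 2) * (ρ * ν + 1) * hρν
  · rw [hT₁x x, Fin.sum_univ_one, Matrix.cons_val_zero, smul_smul]
  · rw [hT₂x x, Fin.sum_univ_two, Matrix.cons_val_zero, Matrix.cons_val_one, Matrix.cons_val_zero, smul_add,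
      smul_smul, smul_smul, add_assoc]

end Main

end Summit.HodgeConjecture.HodgeConjecture.Theorems.SignSymmetricPowersLinkConfluenceNSolo

end
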